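import Mathlib
import HarnessLib
import Summits.ResolutionOfSingularities.ResolutionOfSingularities.Theorems.HomologicalConductorPersistenceLostCertificate

/-!
# K-SD0 / SD-N2: the RANK-ONE CEILING for a hypersurface `S ⧸ (g·h)` — `caᵐ(S ⧸ (gh)) ⊆ (g, h)`

Route `ResolutionOfSingularities/HomologicalConductor`, chain W4.4b, kill-test slot K-SD0 on
`StrictDrop` (stmt-ResolutionOfSingularities-16485), memo SD-N2 (res-L1-w44b-stub-1 gen 4,
`L/res-L1-w44b-stub-1/sd/SD-N2.md`) §1.2 step (C).  [OURS · L1 w44b; AI-written, weaker than expert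
review; NOT a statement of the manuscript under review (Hironaka 2017), and no statement of it is used.]

For a noetherian commutative ring `S` and `g h ∈ S` with `g·h` a non-zero-divisor, the rank-one matrix
factorisation `(g)(h) = gh` and the tree's LOST criterion
(`LostCertificate.not_mem_cohomologyAnnihilatorOfDegree_of_not_exists_certificate`, res-D-pv-026 / 058)
give: every `x ∈ S` whose class lies in `caᵐ(S ⧸ (gh))` for some `m` lies in the ideal `(g, h)`
(a certificate `x·1 = G·(h) + (g)·E` of `1 × 1` matrices is exactly a membership `x ∈ (g, h)`).
Ideal form: `(caᵐ(S ⧸ (gh))).comap mk ≤ span {g, h}` and `caᵐ(S ⧸ (gh)) ≤ (span {g, h}).map mk`.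

This is step (C) of THEOREM NC of the memo (for `f = zᵃtᵇuᶜ`: `ca ⊆ (tᵇuᶜ, zᵃ) ∩ (zᵃuᶜ, tᵇ) ∩ (zᵃtᵇ, uᶜ)`)
and, applied to all splittings `f = g·(f/g)`, the «rank-one bound» `U` of that memo; it is stated for an
arbitrary noetherian `S`, so it serves every hypersurface stage of the cA ARENA as well.

References (mechanism only): D. Eisenbud, Trans. AMS 260 (1980); S. B. Iyengar, R. Takahashi, IMRN 2016
[`IyengarTakahashi2014`].
-/

noncomputable section

-- single-problem summit: the doubled namespace component `ResolutionOfSingularities` is forced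
set_option linter.dupNamespace false

namespace Summit.ResolutionOfSingularities.ResolutionOfSingularities.Theorems.HomologicalConductor.RankOneCeiling

open Literature.RingTheory.CohomologyAnnihilator
open Summit.ResolutionOfSingularities.ResolutionOfSingularities.Theorems.HomologicalConductor.LostCertificate
open Matrix

universe u

variable {S : Type u} [CommRing S]

/-- A `1 × 1` certificate `x·1 = G·(h) + (g)·E` forces `x ∈ (g, h)`. [folklore] -/
theorem mem_span_pair_of_certificate (g h x : S)
    (hc : ∃ G E : Matrix (Fin 1) (Fin 1) S,
      x • (1 : Matrix (Fin 1) (Fin 1) S) = G * !![h] + !![g] * E) :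
    x ∈ Ideal.span ({g, h} : Set S) := by
  obtain ⟨G, E, hGE⟩ := hc
  have h00 := congr_fun (congr_fun hGE 0) 0
  simp only [Matrix.smul_apply, Matrix.one_apply_eq, smul_eq_mul, mul_one, Matrix.add_apply,
    Matrix.mul_apply, Fin.sum_univ_one, Matrix.of_apply, Matrix.cons_val', Matrix.cons_val_fin_one,
    Matrix.empty_val'] at h00
  rw [h00]
  refine Ideal.add_mem _ ?_ ?_
  · exact Ideal.mul_mem_left _ _ (Ideal.subset_span (by simp))
  · exact Ideal.mul_mem_right _ _ (Ideal.subset_span (by simp))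

/-- **Rank-one ceiling** (element form): `S` noetherian, `g·h ∈ S⁰`, `x ∉ (g, h)` ⇒
`x̄ ∉ caᵐ(S ⧸ (gh))` for every `m`. [OURS · L1 w44b] -/
theorem not_mem_cohomologyAnnihilatorOfDegree_of_not_mem_span_pair [IsNoetherianRing S] (g h : S)
    (hgh : g * h ∈ nonZeroDivisors S) (x : S) (hx : x ∉ Ideal.span ({g, h} : Set S)) (m : ℕ) :
    Ideal.Quotient.mk (Ideal.span ({g * h} : Set S)) x ∉
      cohomologyAnnihilatorOfDegree (S ⧸ Ideal.span ({g * h} : Set S)) m := by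
  have hg : g ∈ nonZeroDivisors S := (mul_mem_nonZeroDivisors.mp hgh).1
  refine not_mem_cohomologyAnnihilatorOfDegree_of_not_exists_certificate (g * h) hgh
    (n := 1) !![g] !![h] ?_ ?_ ?_ x (fun hc => hx (mem_span_pair_of_certificate g h x hc)) m
  · ext i j
    fin_cases i; fin_cases j
    simp [Matrix.mul_apply]
  · ext i j
    fin_cases i; fin_cases j
    simp [Matrix.mul_apply, mul_comm]
  · rwa [Matrix.det_fin_one_of]

/-- **Rank-one ceiling** (ideal form): `S` noetherian, `g·h ∈ S⁰` ⇒ the pull-back of `caᵐ(S ⧸ (gh))`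
to `S` is contained in `(g, h)`. [OURS · L1 w44b] -/
theorem comap_cohomologyAnnihilatorOfDegree_le_span_pair [IsNoetherianRing S] (g h : S)
    (hgh : g * h ∈ nonZeroDivisors S) (m : ℕ) :
    (cohomologyAnnihilatorOfDegree (S ⧸ Ideal.span ({g * h} : Set S)) m).comap
        (Ideal.Quotient.mk (Ideal.span ({g * h} : Set S))) ≤
      Ideal.span ({g, h} : Set S) := by
  intro x hx
  by_contra hxn
  exact not_mem_cohomologyAnnihilatorOfDegree_of_not_mem_span_pair g h hgh x hxn m
    (Ideal.mem_comap.mp hx)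

/-- **Rank-one ceiling** (quotient-ideal form): `caᵐ(S ⧸ (gh)) ≤ (g, h)·(S ⧸ (gh))`. [OURS · L1 w44b] -/
theorem cohomologyAnnihilatorOfDegree_le_map_span_pair [IsNoetherianRing S] (g h : S)
    (hgh : g * h ∈ nonZeroDivisors S) (m : ℕ) :
    cohomologyAnnihilatorOfDegree (S ⧸ Ideal.span ({g * h} : Set S)) m ≤
      (Ideal.span ({g, h} : Set S)).map (Ideal.Quotient.mk (Ideal.span ({g * h} : Set S))) := by
  intro y hy
  obtain ⟨x, rfl⟩ := Ideal.Quotient.mk_surjective y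
  exact Ideal.mem_map_of_mem _
    (comap_cohomologyAnnihilatorOfDegree_le_span_pair g h hgh m (Ideal.mem_comap.mpr hy))

end Summit.ResolutionOfSingularities.ResolutionOfSingularities.Theorems.HomologicalConductor.RankOneCeiling

end
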